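import Mathlib
import HarnessLib
import Summits.Langlands.Langlands.Theses.SkinnerWilesDefectOne
import Summits.Langlands.Langlands.Theorems.SkinnerWilesDefectOneReducibleOrdinaryProModularDefs
import Summits.Langlands.Langlands.Theorems.SkinnerWilesDefectOneProModularOfEisensteinSeedProModularPrimes
import Literature.NumberTheory.GaloisRepresentations.NearlyOrdinaryDeformationRing

/-!
# Pro-modular primes versus `p`-adically automorphic points: the exit `ker φ ⟹ ρ`

Route `SkinnerWilesDefectOne`, support item stmt-Langlands-14718
(`ProModularOfEisensteinSeed : EisensteinProModularSeed → ReducibleOrdinaryProModular`, Skinner–Wiles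
steps (I)+(III) at defect one).  Skinner–Wiles propagate pro-modularity along PRIMES of the nearly
ordinary deformation ring `R_𝒟` ([SW, §4.1]: "a deformation `ρ : Gal(F_Σ/F) → GL₂(A)` of type `𝒟` is
a pro-modular deformation if the kernel of the corresponding map `R_𝒟 → A` is a pro-modular prime"),
while the route's seed and engine speak of `p`-adically automorphic POINTS `Γ_F → GL₂(ℚ̄_p)`
(`TameLevel.IsPadicallyAutomorphic`).  This file proves the formal exit of that dictionary, the last
step of stub S5 of line `steinberg_hyperplane` ("hence `𝔭_ρ` (going up), hence `ρ` via `φ`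
(`Models.realizes`)"):

* `isPadicallyAutomorphic_of_isProModularPrimeAt_ker` — if `φ : R_𝒟 → ℚ̄_p` is CONTINUOUS for the
  `𝔪`-adic topology, `φ ∘ ρ_𝒟` is a `GL₂(ℚ̄_p)`-conjugate of the continuous `ρ : Γ_F → GL₂(ℚ̄_p)`
  (the shape of `ModelData.Models.realizes`) and the prime `ker φ` is pro-modular at the tame level `𝒰`
  (`IsProModularPrimeAt`), then `ρ` is `p`-adically automorphic of level `𝒰`: the point is
  `(R_𝒟/ker φ ↪ ℚ̄_p) ∘ x`, continuous by `continuous_kerLift_adic`; unramifiedness and the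
  Hecke–Frobenius characteristic polynomials are pushed along `φ` and across the conjugation.
  Continuity of `φ` is kept as an explicit hypothesis (for the classifying map of an `𝒪_E`-lattice it
  holds by construction: a local `𝒪`-algebra map into `𝒪_E`);
* `isPadicallyAutomorphic_of_isProModularPrimeAt_of_le` — the same from any pro-modular prime
  `𝔮 ⊆ ker φ` (e.g. the minimal prime of a pro-modular component through `𝔭_ρ`), by the landed going-up
  `IsProModularPrimeAt.of_le`.

References: C. M. Skinner, A. J. Wiles, *Residually reducible representations and modular forms*,
Publ. Math. IHÉS 89 (1999), §4.1 (p. 62). [SkinnerWiles1999]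
-/

set_option linter.dupNamespace false -- project-wide option (lakefile weak.linter.dupNamespace); `Summit.Langlands.Langlands` is the mandated namespace

namespace Summit.Langlands.Langlands.Cruxes.ReducibleOrdinaryProModular.SteinbergHyperplane

open scoped NumberField MatrixGroups
open IsDedekindDomain Field Polynomial Matrix IsLocalRing Filter
open Literature.NumberTheory.Automorphic Literature.NumberTheory.Automorphic.BigHeckeGLn
open Literature.NumberTheory.GaloisRepresentations

noncomputable section

/-! ### Continuity of the factorisation through `R/ker φ` -/

/-- **The injection `R/ker φ ↪ B` induced by a continuous `φ` is continuous** for the `𝔪`-adic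
topology on the quotient (`𝔪` any ideal of `R`, e.g. the maximal ideal): a neighbourhood of `0` in
`B` pulls back under `φ` to some `𝔪ⁿ`, whose image is `(𝔪·R/ker φ)ⁿ`. [folklore] -/
theorem continuous_kerLift_adic {R B : Type*} [CommRing R] [CommRing B] [TopologicalSpace B]
    [IsTopologicalRing B] (𝔪 : Ideal R) (φ : R →+* B)
    (hφ : @Continuous R B 𝔪.adicTopology _ φ) :
    @Continuous (R ⧸ RingHom.ker φ) B ((𝔪.map (Ideal.Quotient.mk (RingHom.ker φ))).adicTopology) _
      (RingHom.kerLift φ) := by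
  letI : WithIdeal (R ⧸ RingHom.ker φ) := ⟨𝔪.map (Ideal.Quotient.mk (RingHom.ker φ))⟩
  refine continuous_of_continuousAt_zero (RingHom.kerLift φ) ?_
  rw [ContinuousAt, map_zero, (Ideal.hasBasis_nhds_zero_adic _).tendsto_left_iff]
  intro U hU
  have h0 : Tendsto φ (@nhds R 𝔪.adicTopology 0) (nhds 0) := by
    have := @Continuous.tendsto R B 𝔪.adicTopology _ φ hφ 0
    rwa [map_zero] at this
  obtain ⟨n, -, hn⟩ := (𝔪.hasBasis_nhds_zero_adic.tendsto_left_iff).mp h0 U hU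
  refine ⟨n, trivial, fun y hy => ?_⟩
  change y ∈ ((𝔪.map (Ideal.Quotient.mk (RingHom.ker φ))) ^ n : Ideal _) at hy
  rw [← Ideal.map_pow, Ideal.mem_map_iff_of_surjective _ Ideal.Quotient.mk_surjective] at hy
  obtain ⟨r, hr, rfl⟩ := hy
  rw [RingHom.kerLift_mk]
  exact hn hr

variable {F : Type} [Field F] [NumberField F] {p : ℕ} [Fact p.Prime]
variable {𝒪 : Type} [CommRing 𝒪] {k : Type} [Field k] [Algebra 𝒪 k] {𝒟 : NearlyOrdinaryDatum F p 𝒪 k}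
variable (𝓡 : NearlyOrdinaryDeformationRing.{0} 𝒟)

/-- The prime `ker φ` of `R_𝒟` of a point `φ : R_𝒟 → ℚ̄_p`, as a point of `Spec R_𝒟`. [folklore] -/
theorem ker_isPrime (φ : 𝓡.R →+* PadicAlgCl p) : (RingHom.ker φ).IsPrime :=
  RingHom.ker_isPrime φ

/-- **Exit of the prime/point dictionary: a pro-modular `ker φ` makes `ρ` `p`-adically automorphic.**
Let `φ : R_𝒟 → ℚ̄_p` be continuous (`𝔪_{R_𝒟}`-adic to `p`-adic), let the continuous
`ρ : Γ_F → GL₂(ℚ̄_p)` be realised by `φ` up to conjugation (`φ ∘ ρ_𝒟 = P⁻¹ ρ P`, the shape of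
`ModelData.Models.realizes`), and let the prime `ker φ` be pro-modular at the tame level `𝒰`.  Then `ρ`
is `p`-adically automorphic of level `𝒰`, with the point `(R_𝒟/ker φ ↪ ℚ̄_p) ∘ x`.
[cite: SkinnerWiles1999, §4.1 p. 62 (pro-modular deformations)] -/
theorem isPadicallyAutomorphic_of_isProModularPrimeAt_ker (𝒰 : TameLevel 2 F p)
    (φ : 𝓡.R →+* PadicAlgCl p)
    (hφ : @Continuous 𝓡.R (PadicAlgCl p) (maximalIdeal 𝓡.R).adicTopology _ φ)
    (ρ : FramedGaloisRep F (PadicAlgCl p) 2) (P : GL (Fin 2) (PadicAlgCl p))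
    (hreal : ∀ g, Matrix.GeneralLinearGroup.map φ (𝓡.ρ g) = P⁻¹ * ρ g * P)
    (hpro : IsProModularPrimeAt 𝓡 𝒰 ⟨RingHom.ker φ, ker_isPrime 𝓡 φ⟩) :
    𝒰.IsPadicallyAutomorphic ρ := by
  obtain ⟨x, hx, hass⟩ := hpro
  -- the point `x' = (R/ker φ ↪ ℚ̄_p) ∘ x`
  set ι : 𝓡.R ⧸ RingHom.ker φ →+* PadicAlgCl p := RingHom.kerLift φ with hι
  have hιmk : ι.comp (Ideal.Quotient.mk (RingHom.ker φ)) = φ := RingHom.ext fun r => RingHom.kerLift_mk φ r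
  -- `φ ∘ ρ_𝒟 = ι ∘ (ρ_𝒟 mod ker φ)`
  have hmod : ∀ g, Matrix.GeneralLinearGroup.map ι (𝓡.modPrime ⟨RingHom.ker φ, ker_isPrime 𝓡 φ⟩ g) =
      P⁻¹ * ρ g * P := fun g => by
    change Matrix.GeneralLinearGroup.map ι
      (Matrix.GeneralLinearGroup.map (Ideal.Quotient.mk (RingHom.ker φ)) (𝓡.ρ g)) = _
    rw [← Matrix.GeneralLinearGroup.map_comp_apply, ← Matrix.GeneralLinearGroup.map_comp, hιmk,
      hreal]
  refine ⟨ι.comp x, ?_, fun v hv => ?_⟩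
  · exact @Continuous.comp _ _ _ _
      ((maximalIdeal 𝓡.R).map (Ideal.Quotient.mk (RingHom.ker φ))).adicTopology _ _ _
      (continuous_kerLift_adic (maximalIdeal 𝓡.R) φ hφ) hx
  · obtain ⟨hunr, hchar⟩ := hass v hv
    refine ⟨fun 𝔓 h𝔓 σ hσ => ?_, fun 𝔓 h𝔓 σ hσ => ?_⟩
    · -- unramified: `ρ_𝒟 σ ≡ 1 mod ker φ`, so `P⁻¹ ρ(σ) P = 1`
      have h1 := hunr 𝔓 h𝔓 σ hσ
      have h2 := hmod σ
      rw [h1, map_one] at h2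
      -- `1 = P⁻¹ ρ σ P` ⟹ `ρ σ = 1`
      have h3 : ρ σ = P * 1 * P⁻¹ := by rw [h2]; group
      rw [h3]; group
    · -- characteristic polynomial of Frobenius, pushed along `ι` and across the conjugation
      have hc := congrArg (Polynomial.map ι) (hchar 𝔓 h𝔓 σ hσ)
      rw [heckeFrobPoly_map, ← Matrix.charpoly_map] at hc
      have hmat : ((𝓡.modPrime ⟨RingHom.ker φ, ker_isPrime 𝓡 φ⟩ σ).val).map ι =
          (P⁻¹ * ρ σ * P).val := by
        rw [← hmod σ]; rfl
      rw [hmat, Units.val_mul, Units.val_mul, Matrix.coe_units_inv, Matrix.charpoly_units_conj'] at hc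
      exact hc

/-- **From any pro-modular prime below `ker φ`** (e.g. the minimal prime of a pro-modular component of
`Spec R_𝒟` passing through `𝔭_ρ = ker φ`): going up (`IsProModularPrimeAt.of_le`, [SW, §4.1 p. 62])
and the exit above. [cite: SkinnerWiles1999, §4.1 p. 62] -/
theorem isPadicallyAutomorphic_of_isProModularPrimeAt_of_le (𝒰 : TameLevel 2 F p)
    (φ : 𝓡.R →+* PadicAlgCl p)
    (hφ : @Continuous 𝓡.R (PadicAlgCl p) (maximalIdeal 𝓡.R).adicTopology _ φ)
    (ρ : FramedGaloisRep F (PadicAlgCl p) 2) (P : GL (Fin 2) (PadicAlgCl p))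
    (hreal : ∀ g, Matrix.GeneralLinearGroup.map φ (𝓡.ρ g) = P⁻¹ * ρ g * P)
    {𝔮 : PrimeSpectrum 𝓡.R} (h𝔮 : 𝔮.asIdeal ≤ RingHom.ker φ) (hpro : IsProModularPrimeAt 𝓡 𝒰 𝔮) :
    𝒰.IsPadicallyAutomorphic ρ :=
  isPadicallyAutomorphic_of_isProModularPrimeAt_ker 𝓡 𝒰 φ hφ ρ P hreal
    (IsProModularPrimeAt.of_le 𝓡
      ((PrimeSpectrum.asIdeal_le_asIdeal 𝔮 ⟨RingHom.ker φ, ker_isPrime 𝓡 φ⟩).mp h𝔮) hpro)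

end

end Summit.Langlands.Langlands.Cruxes.ReducibleOrdinaryProModular.SteinbergHyperplane
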